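import Summits.BirchSwinnertonDyer.BirchSwinnertonDyer.Theorems.ByReductionTypeAtTwoSupersingularFlatBlindLevelRaise
import Summits.BirchSwinnertonDyer.Rank1Residual.X11b.LevelShiftMaps
import Literature.NumberTheory.EllipticCurves.SelmerLevelToPrimary
import Literature.NumberTheory.EllipticCurves.PointDivisibilityProofs
import Literature.NumberTheory.EllipticCurves.SelmerLocalConditionUnramifiedUniform
import HarnessLib

/-!
# HT-C6 (B2 Tamagawa splitting), tool file 1/3: LEVEL LOWERING of bounded-exponent classes and the DEATH of their
# Kummer localisations at a place `ℓ ∤ p` (crux `SupersingularRankZeroAtTwo` = stmt-BirchSwinnertonDyer-19097, line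
# `odd_blind_package`, slot 5 CDC_H, glue binder hB2; cell `bsd-2adic`, seat `bsd-2adic-t42` GEN 41)

THEOREMS ONLY (no definition, no named fact, no instance, no `sorry`); `--supports stmt-BirchSwinnertonDyer-19097 --as
helper`; `W`-, `p`-generic over `ℚ`; closes nothing; BSD is proved for no curve.

* `exists_pow_smul_eq_zero_of_isTorsion_adicCompletion` — an exponent `e` with `p^e · P = 0` for every `p`-power-torsion
  point `P ∈ W(ℚ_ℓ)` (`W(ℚ_ℓ)_tors` is finite, tree `finite_addTorsion_point_adicCompletion_rat`).
* `exists_map_torsionInclusion_eq_of_pow_smul_eq_zero` — **level lowering**: with no `Γ`-fixed point in `W[p^∞]` (`W(K)[p] = 0`), a class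
  `x ∈ H¹(ℚ, W[p^J])` with `p^c x = 0` (`c ≤ J`) is `H¹(ι)(z)` for a class `z ∈ H¹(ℚ, W[p^c])`, `ι : W[p^c] ↪ W[p^J]`
  (through `W[p^∞]`: `im H¹(ι_c) = H¹(ℚ, W[p^∞])[p^c]`, `H¹(ι_J)` injective; X11b `Levels`).
* `localization_eq_zero_of_pow_smul_eq_zero_of_mem_kummer` — **a bounded-exponent global class whose localisation at
  `ℓ ∤ p` is a Kummer class has ZERO localisation there once `J ≥ c + e`**: lower the level to `p^c`, read the
  localisation of the lowered class in the level-`p^c` Kummer condition (same map to `H¹(ℚ_ℓ, W)`), and apply HT-C4(c)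
  (★ p814002 `FlatBlindLevelPassage.HTC4_map_torsionInclusion_kummerLocalConditionAt_eq_bot`: `H¹(ι)` kills level-`p^c`
  Kummer classes at level `J ≥ c + e`).

References: [GreenbergLNM1716] §5 proof of Prop. 5.8 (levels `E[p^k] ↪ E[p^∞]`), §3 Lemma 3.3; [MilneADT2006] I Lemma 3.3;
[SilvermanAEC2009] VII.6.3, X.§4.
-/

set_option autoImplicit false
set_option linter.dupNamespace false

noncomputable section

open scoped Classical NumberField ContRepresentation

namespace Summit.BirchSwinnertonDyer.BirchSwinnertonDyer.Theorems

namespace FlatBlindTamagawaSplitting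

open NumberField IsDedekindDomain Field WeierstrassCurve Literature.NumberTheory.EllipticCurves
  Literature.NumberTheory.GaloisRepresentations Literature.NumberTheory.GaloisCohomology
open Summit.BirchSwinnertonDyer.Rank1Residual.X11b

/-! ## §1 An exponent killing the `p`-power torsion of `W(ℚ_ℓ)` -/

/-- **There is `e` with `p^e · P = 0` for every `p`-power-torsion point `P ∈ W(ℚ_ℓ)`** (`W(ℚ_ℓ)_tors` is finite: take
`e = #W(ℚ_ℓ)_tors`; the order `p^i` of such a `P` divides it, so `i ≤ p^i ≤ e`). [cite: SilvermanAEC2009, Prop. VII.6.3] -/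
theorem exists_pow_smul_eq_zero_of_isTorsion_adicCompletion (W : WeierstrassCurve ℚ) [W.IsElliptic] (p : ℕ)
    [hp : Fact p.Prime] (ℓ : HeightOneSpectrum (𝓞 ℚ)) :
    ∃ e : ℕ, ∀ P : (W.baseChange (ℓ.adicCompletion ℚ)).toAffine.Point, (∃ k : ℕ, p ^ k • P = 0) → p ^ e • P = 0 := by
  haveI := finite_addTorsion_point_adicCompletion_rat W ℓ
  set m := Nat.card (AddCommGroup.torsion (W.baseChange (ℓ.adicCompletion ℚ)).toAffine.Point) with hm
  refine ⟨m, fun P ⟨k, hk⟩ ↦ ?_⟩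
  have hfin : IsOfFinAddOrder P :=
    isOfFinAddOrder_iff_nsmul_eq_zero.2 ⟨p ^ k, pow_pos hp.out.pos k, hk⟩
  let t : AddCommGroup.torsion (W.baseChange (ℓ.adicCompletion ℚ)).toAffine.Point := ⟨P, hfin⟩
  have h1 : addOrderOf P ∣ m := by
    have h := addOrderOf_dvd_natCard t
    rwa [← AddSubgroup.addOrderOf_coe t] at h
  have h2 : addOrderOf P ∣ p ^ k := addOrderOf_dvd_iff_nsmul_eq_zero.2 hk
  obtain ⟨i, -, hi⟩ := (Nat.dvd_prime_pow hp.out).1 h2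
  have hmpos : 0 < m := Nat.card_pos
  have him : i ≤ m := by
    have h3 : p ^ i ≤ m := by rw [← hi]; exact Nat.le_of_dvd hmpos h1
    exact (Nat.lt_pow_self hp.out.one_lt).le.trans h3
  have h4 : addOrderOf P ∣ p ^ m := by rw [hi]; exact pow_dvd_pow p him
  exact addOrderOf_dvd_iff_nsmul_eq_zero.1 h4

/-! ## §2 Level lowering through `W[p^∞]` -/

/-- **Level lowering**: for `W(ℚ)[p] = 0` (indeed over any number field `K`), a class `x ∈ H¹(K, W[p^J])` killed by
`p^c`, `c ≤ J`, is the image of a class of `H¹(K, W[p^c])` under `H¹(ι)`, `ι : W[p^c] ↪ W[p^J]` the inclusion: push to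
`W[p^∞]`, where `im H¹(ι_c) = H¹(K, W[p^∞])[p^c]` (X11b `Levels.mem_range_map_primaryInclusion_iff`, divisibility of
`W(K̄)`) and `H¹(ι_J)` is injective (`Levels.map_primaryInclusion_injective`, no `Γ_K`-fixed point in `W[p^∞]` — the
hypothesis `hΓ`, e.g. from `W(K)[p] = 0` by `geomPrimaryTorsion_eq_zero_of_forall_smul_eq`). [cite: GreenbergLNM1716, §5 proof of Prop. 5.8 and §2 p. 63] -/
theorem exists_map_torsionInclusion_eq_of_pow_smul_eq_zero {K : Type} [Field K] [NumberField K]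
    (W : WeierstrassCurve K) [W.IsElliptic] (p : ℕ) [hp : Fact p.Prime]
    (hΓ : ∀ Q : W.geomPrimaryTorsion p, (∀ σ : absoluteGaloisGroup K, σ • Q = Q) → Q = 0) {c J : ℕ} (hcJ : c ≤ J)
    (x : galoisCohomology (W.torsionGaloisModule ((p ^ J : ℕ) : ℤ)) 1) (hx : p ^ c • x = 0) :
    ∃ z : galoisCohomology (W.torsionGaloisModule ((p ^ c : ℕ) : ℤ)) 1,
      galoisCohomology.map (W.torsionInclusion (d := ((p ^ c : ℕ) : ℤ)) (N := ((p ^ J : ℕ) : ℤ))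
        (Int.natCast_dvd_natCast.mpr (Nat.pow_dvd_pow p hcJ))) 1 z = x := by
  set ιJ := Levels.primaryInclusion W p J with hιJ
  set ιc := Levels.primaryInclusion W p c with hιc
  have hy : p ^ c • galoisCohomology.map ιJ 1 x = 0 := by rw [← map_nsmul, hx, map_zero]
  obtain ⟨z, hz⟩ := (Levels.mem_range_map_primaryInclusion_iff W p c W.zsmul_geomPoints_surjective_holds
    (galoisCohomology.map ιJ 1 x)).2 hy
  refine ⟨z, ?_⟩
  have hΓ' : ∀ Q : W.geomPrimaryTorsion p,
      (∀ σ : absoluteGaloisGroup K, LocBridge.primaryGaloisModule W p σ Q = Q) → Q = 0 :=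
    fun Q hQ ↦ hΓ Q fun σ ↦ by
      have h := hQ σ
      simpa only [LocBridge.primaryGaloisModule, LocBridge.ofSMul_apply_apply] using h
  apply Levels.map_primaryInclusion_injective W p J hΓ'
  rw [← hz]
  exact Levels.map_map_eq_map_of_comp_eq _ ιJ ιc (fun a ↦ Subtype.ext rfl) z

/-! ## §3 Bounded-exponent global classes with Kummer localisation at `ℓ ∤ p` localise to zero at large level -/

/-- **A global class `x ∈ H¹(ℚ, W[p^J])` with `p^c x = 0` whose localisation at a place `ℓ ∤ p` lies in the Kummer
condition has ZERO localisation at `ℓ` as soon as `J ≥ c + e`** (no `Γ_ℚ`-fixed point in `W[p^∞]`, e.g. `W(ℚ)[p] = 0`;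
`p^e` kills `W(ℚ_ℓ)[p^∞]`): write
`x = H¹(ι) z` at level `p^c` (§2); `loc_ℓ z` is a level-`p^c` Kummer class (the composite `W[p^c] ↪ W[p^J] → W(ℚ̄_ℓ)` is
the level-`p^c` points map); HT-C4(c) (`FlatBlindLevelPassage.HTC4_map_torsionInclusion_kummerLocalConditionAt_eq_bot`,
★ p814002) kills `H¹(ι)` on level-`p^c` Kummer classes at `ℓ` for `J ≥ c + e`. [cite: GreenbergLNM1716, §3 Lemma 3.3 and §5 Prop. 5.8]
[cite: MilneADT2006, I Lemma 3.3] -/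
theorem localization_eq_zero_of_pow_smul_eq_zero_of_mem_kummer (W : WeierstrassCurve ℚ) [W.IsElliptic] (p : ℕ)
    [hp : Fact p.Prime] (hΓ : ∀ Q : W.geomPrimaryTorsion p, (∀ σ : absoluteGaloisGroup ℚ, σ • Q = Q) → Q = 0)
    (ℓ : HeightOneSpectrum (𝓞 ℚ)) (hℓ : ((p : ℕ) : 𝓞 ℚ) ∉ ℓ.asIdeal) (e : ℕ)
    (he : ∀ P : (W.baseChange (ℓ.adicCompletion ℚ)).toAffine.Point, (∃ k : ℕ, p ^ k • P = 0) → p ^ e • P = 0)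
    {c J : ℕ} (hJ : c + e ≤ J)
    (x : galoisCohomology (W.torsionGaloisModule ((p ^ J : ℕ) : ℤ)) 1) (hx : p ^ c • x = 0)
    (hloc : galoisCohomology.localization (W.torsionGaloisModule ((p ^ J : ℕ) : ℤ)) (Sum.inr ℓ) 1 x ∈
      W.kummerLocalConditionAt ((p ^ J : ℕ) : ℤ) (ℓ.adicCompletion ℚ)) :
    galoisCohomology.localization (W.torsionGaloisModule ((p ^ J : ℕ) : ℤ)) (Sum.inr ℓ) 1 x = 0 := by
  have hcJ : c ≤ J := le_trans (Nat.le_add_right c e) hJ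
  obtain ⟨z, rfl⟩ := exists_map_torsionInclusion_eq_of_pow_smul_eq_zero W p hΓ hcJ x hx
  set ι := W.torsionInclusion (d := ((p ^ c : ℕ) : ℤ)) (N := ((p ^ J : ℕ) : ℤ))
    (Int.natCast_dvd_natCast.mpr (Nat.pow_dvd_pow p hcJ)) with hι
  -- naturality of localisation
  have hnat : galoisCohomology.localization (W.torsionGaloisModule ((p ^ J : ℕ) : ℤ)) (Sum.inr ℓ) 1
        (galoisCohomology.map ι 1 z) =
      galoisCohomology.map (ι.restrictField (ℓ.adicCompletion ℚ)) 1
        (galoisCohomology.localization (W.torsionGaloisModule ((p ^ c : ℕ) : ℤ)) (Sum.inr ℓ) 1 z) :=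
    galoisCohomology.res_map_one (ℓ.adicCompletion ℚ) ι z
  rw [hnat] at hloc ⊢
  -- the lowered localisation is a level-`p^c` Kummer class
  have hzK : galoisCohomology.localization (W.torsionGaloisModule ((p ^ c : ℕ) : ℤ)) (Sum.inr ℓ) 1 z ∈
      W.kummerLocalConditionAt ((p ^ c : ℕ) : ℤ) (ℓ.adicCompletion ℚ) := by
    have h1 := (WeierstrassCurve.mem_kummerLocalConditionAt_iff W _ _ _).1 hloc
    refine (WeierstrassCurve.mem_kummerLocalConditionAt_iff W _ _ _).2 ?_
    calc galoisCohomology.map (W.torsionPointsMapIntertwining ((p ^ c : ℕ) : ℤ) (ℓ.adicCompletion ℚ)) 1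
          (galoisCohomology.localization (W.torsionGaloisModule ((p ^ c : ℕ) : ℤ)) (Sum.inr ℓ) 1 z)
        = galoisCohomology.map (W.torsionPointsMapIntertwining ((p ^ J : ℕ) : ℤ) (ℓ.adicCompletion ℚ)) 1
          (galoisCohomology.map (ι.restrictField (ℓ.adicCompletion ℚ)) 1
            (galoisCohomology.localization (W.torsionGaloisModule ((p ^ c : ℕ) : ℤ)) (Sum.inr ℓ) 1 z)) :=
          (Levels.map_map_eq_map_of_comp_eq
            (ρ₁ := GaloisRep.restrictField (ℓ.adicCompletion ℚ) (W.torsionGaloisModule ((p ^ c : ℕ) : ℤ)))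
            (ρ₂ := GaloisRep.restrictField (ℓ.adicCompletion ℚ) (W.torsionGaloisModule ((p ^ J : ℕ) : ℤ)))
            (ρ₃ := W.localGaloisModule (ℓ.adicCompletion ℚ))
            (ι.restrictField (ℓ.adicCompletion ℚ))
            (W.torsionPointsMapIntertwining ((p ^ J : ℕ) : ℤ) (ℓ.adicCompletion ℚ))
            (W.torsionPointsMapIntertwining ((p ^ c : ℕ) : ℤ) (ℓ.adicCompletion ℚ)) (fun a ↦ rfl) _).symm
      _ = 0 := h1
  -- HT-C4(c): `H¹(ι)` kills the level-`p^c` Kummer condition at level `J ≥ c + e`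
  have hbot := FlatBlindLevelPassage.HTC4_map_torsionInclusion_kummerLocalConditionAt_eq_bot W p ℓ hℓ e he hJ
  have hmem : galoisCohomology.map (ι.restrictField (ℓ.adicCompletion ℚ)) 1
      (galoisCohomology.localization (W.torsionGaloisModule ((p ^ c : ℕ) : ℤ)) (Sum.inr ℓ) 1 z) ∈
      (W.kummerLocalConditionAt ((p ^ c : ℕ) : ℤ) (ℓ.adicCompletion ℚ)).map
        (galoisCohomology.map (ι.restrictField (ℓ.adicCompletion ℚ)) 1) :=
    AddSubgroup.mem_map_of_mem _ hzK
  rw [hbot, AddSubgroup.mem_bot] at hmem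
  exact hmem

end FlatBlindTamagawaSplitting

end Summit.BirchSwinnertonDyer.BirchSwinnertonDyer.Theorems

end
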